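import Summits.CriticalPhenomena.PercolationContinuityZ3.Theses.PercNearOneGluing
import Literature.Probability.Percolation.PercolationProofs
import Literature.Probability.Percolation.ConditionalPositiveAssociationProofs
import Literature.Probability.Percolation.TwoClusterConditionalAssociationProofs

/-! TTRL-lite variant V1430 of stmt-CriticalPhenomena-4576

**Verdict: DISPROVED.**  V1430 drops every side hypothesis of the good-step inequality
(`stub_goodStep` of the crux `PercNearOneGluing.AdditiveGluing`) and asks, for an arbitrary relay
`a ∈ A`, that `μ((o ↔ A) ∩ (a ↔ b)) ≤ μ(o ↔ b)`.  This fails as soon as the relay that `o` reaches is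
not the relay `a` that reaches `b`: witness `n = 5`, `o = 0`, `b = 1`, `a = 3`, `A = {1, 2, 3}`
(so even `b ∈ A`, `o ∉ A`, `a ≠ b`, and `o` has a sure neighbour `4 ∉ A`), deterministic weight
`w = 𝟙_{ {s(0,2), s(1,3), s(0,4)} }`.  Under a `0/1` weight `prodBernoulli w` is the point mass at
`ω₀ = {s(0,2), s(1,3), s(0,4)}` (`cp4576_goodstep_var1430_pointMass`, from
`BHK2006.integral_prodBernoulli_eq_sum`); at `ω₀` the left event holds (`0 ∼ 2`, `3 ∼ 1`) while
`0 ↔ 1` fails (the open cluster of `0` is `{0, 2, 4}`), so LHS `= 1 > 0 =` RHS.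
-/

namespace Summit.CriticalPhenomena.PercolationContinuityZ3.Theorems

open MeasureTheory Literature.Probability.LatticeModels Literature.Probability.Percolation
open scoped Classical BigOperators

/-- Under a deterministic (`0/1`-valued) weight `w = 1_{ω₀}` on a finite index type, the product
Bernoulli measure is the point mass at `ω₀`: an event has probability `1` if it contains `ω₀`
and `0` otherwise. [folklore] -/
theorem cp4576_goodstep_var1430_pointMass {ι : Type*} [Fintype ι]
    (w : ι → unitInterval) (ω₀ : Set ι) (hw1 : ∀ e ∈ ω₀, (w e : ℝ) = 1)
    (hw0 : ∀ e ∉ ω₀, (w e : ℝ) = 0) (S : Set (Set ι)) :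
    (prodBernoulli w).real S = if ω₀ ∈ S then 1 else 0 := by
  have hS : MeasurableSet S := S.toFinite.measurableSet
  rw [← integral_indicator_one hS, BHK2006.integral_prodBernoulli_eq_sum,
    Fintype.sum_eq_single ω₀]
  · have hW1 : BHK2006.weight (fun e => (w e : ℝ)) ω₀ = 1 := by
      unfold BHK2006.weight
      refine Finset.prod_eq_one fun e _ => ?_
      by_cases he : e ∈ ω₀
      · simp [hw1 e he, he]
      · simp [hw0 e he, he]
    rw [hW1, one_mul]
    by_cases hmem : ω₀ ∈ S
    · simp [hmem]
    · simp [hmem]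
  · intro ω hne
    have hW0 : BHK2006.weight (fun e => (w e : ℝ)) ω = 0 := by
      unfold BHK2006.weight
      obtain ⟨e, he⟩ : ∃ e, ¬ (e ∈ ω ↔ e ∈ ω₀) :=
        not_forall.1 fun hall => hne (Set.ext hall)
      refine Finset.prod_eq_zero (Finset.mem_univ e) ?_
      by_cases heω : e ∈ ω
      · have heω₀ : e ∉ ω₀ := fun h1 => he (iff_of_true heω h1)
        simp [hw0 e heω₀, heω]
      · have heω₀ : e ∈ ω₀ := by
          by_contra h1
          exact he (iff_of_false heω h1)
        simp [hw1 e heω₀, heω]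
    rw [hW0, zero_mul]

/-- **Variant V1430 is false.** Witness: `n = 5`, `o = 0`, `b = 1`, `a = 3`, `A = {1, 2, 3}`
(so `b ∈ A`, `o ∉ A`, `a ≠ b`), deterministic weight `1` on the edges `s(0,2), s(1,3), s(0,4)` and
`0` elsewhere. Then almost surely the open edges are exactly these three: `o ↔ 2 ∈ A` and `a ↔ b`
hold surely (LHS `= 1`) while the cluster of `o` is `{0, 2, 4} ∌ b` (RHS `= 0`). -/
theorem cp4576_goodstep_var1430_false :
    ¬ (∀ (n : ℕ) (w : Sym2 (Fin n) → unitInterval) (A : Finset (Fin n)) (o b a : Fin n), a ∈ A →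
      (prodBernoulli w).real ((⋃ a' ∈ A, openConn o a') ∩ openConn a b) ≤
        (prodBernoulli w).real (openConn o b)) := by
  intro h
  -- the deterministic weight and its support
  have hw1 : ∀ e ∈ ({s(0, 2), s(1, 3), s(0, 4)} : Set (Sym2 (Fin 5))),
      ((fun e : Sym2 (Fin 5) =>
          if e ∈ ({s(0, 2), s(1, 3), s(0, 4)} : Set (Sym2 (Fin 5))) then (1 : unitInterval) else 0)
        e : ℝ) = 1 := by
    intro e he
    simp only [if_pos he, Set.Icc.coe_one]
  have hw0 : ∀ e ∉ ({s(0, 2), s(1, 3), s(0, 4)} : Set (Sym2 (Fin 5))),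
      ((fun e : Sym2 (Fin 5) =>
          if e ∈ ({s(0, 2), s(1, 3), s(0, 4)} : Set (Sym2 (Fin 5))) then (1 : unitInterval) else 0)
        e : ℝ) = 0 := by
    intro e he
    simp only [if_neg he, Set.Icc.coe_zero]
  have key := h 5
    (fun e => if e ∈ ({s(0, 2), s(1, 3), s(0, 4)} : Set (Sym2 (Fin 5))) then 1 else 0)
    ({1, 2, 3} : Finset (Fin 5)) 0 1 3 (by decide)
  rw [cp4576_goodstep_var1430_pointMass _ _ hw1 hw0,
    cp4576_goodstep_var1430_pointMass _ _ hw1 hw0] at key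
  -- LHS event holds at `ω₀`
  have hL : ({s(0, 2), s(1, 3), s(0, 4)} : Set (Sym2 (Fin 5))) ∈
      (⋃ a' ∈ ({1, 2, 3} : Finset (Fin 5)), openConn (0 : Fin 5) a') ∩ openConn (3 : Fin 5) 1 := by
    refine ⟨?_, ?_⟩
    · simp only [Set.mem_iUnion]
      refine ⟨2, by decide, ?_⟩
      exact SimpleGraph.Adj.reachable ((openGraph_adj _ _ _).2 ⟨by simp, by decide⟩)
    · refine SimpleGraph.Adj.reachable ((openGraph_adj _ _ _).2 ⟨?_, by decide⟩)
      simp [Sym2.eq_swap]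
  -- RHS event fails at `ω₀`: the set `{0, 2, 4}` is closed under open adjacency and misses `1`
  have hR : ({s(0, 2), s(1, 3), s(0, 4)} : Set (Sym2 (Fin 5))) ∉ openConn (0 : Fin 5) (1 : Fin 5) := by
    intro hreach
    change (openGraph _).Reachable 0 1 at hreach
    rw [SimpleGraph.reachable_iff_reflTransGen] at hreach
    have hstep : ∀ x y : Fin 5,
        ((x = 0 ∧ y = 2 ∨ x = 2 ∧ y = 0) ∨ (x = 1 ∧ y = 3 ∨ x = 3 ∧ y = 1) ∨
          (x = 0 ∧ y = 4 ∨ x = 4 ∧ y = 0)) →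
        (x = 0 ∨ x = 2 ∨ x = 4) → (y = 0 ∨ y = 2 ∨ y = 4) := by decide
    have hclosed : ∀ y : Fin 5,
        Relation.ReflTransGen
          (openGraph ({s(0, 2), s(1, 3), s(0, 4)} : Set (Sym2 (Fin 5)))).Adj 0 y →
        (y = 0 ∨ y = 2 ∨ y = 4) := by
      intro y hy
      induction hy with
      | refl => exact Or.inl rfl
      | tail _ hadj ih =>
        rw [openGraph_adj] at hadj
        simp only [Set.mem_insert_iff, Set.mem_singleton_iff, Sym2.eq_iff] at hadj
        exact hstep _ _ hadj.1 ih
    have := hclosed 1 hreach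
    simp at this
  rw [if_pos hL, if_neg hR] at key
  norm_num at key

end Summit.CriticalPhenomena.PercolationContinuityZ3.Theorems
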